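import Summits.BirchSwinnertonDyer.BirchSwinnertonDyer.Theorems.GenusKolyvaginAtTwoPowDvdShaCardAtTwoRTRungSupplyIntrinsic
import Summits.BirchSwinnertonDyer.BirchSwinnertonDyer.Theorems.CMKolyvaginAtInertTwoKolyvaginRelationAtTwoOfSurj
import HarnessLib

/-!
# Route `CMKolyvaginAtInertTwo`, crux `CMKolyvaginExactAtInertTwo` (stmt-BirchSwinnertonDyer-24277), `stub_lower` —
# PORT OF gk2's LINE 18, FILE A: THE K-SIDE RUNG SUPPLY AT `2` WITHOUT THE `¬ HasCM` / full-`2`-adic-image BINDERS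

Seat `bsd-line-cmk2-p1` g19 (cell `bsd-print-cf2`), `--supports stmt-BirchSwinnertonDyer-24277` (helper; closes nothing).
THEOREMS ONLY (no definition, no named fact, no `sorry`).  BSD is NOT proved by any of this; the crux is not closed here.

WHAT.  gk2's K-side rung supply for McCallum's Prop. 5.2 at `2` (`…RTRungSupplyKolyvagin`, `…RTRungSupplySeparation`,
`…RTRungSupplyIntrinsic`, seat gk2-p2) consumes the `GenusKolyvaginAtTwo` route decl Q2 `KolyvaginRelationAtTwo` BY NAME — a
`∀`-statement binding `¬ W.HasCM` and the surjective `2`-adic tower, both FALSE on the CM-inert habitat H₂ of 24277.  Reading the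
gk2 proofs shows that these two binders are used ONLY to instantiate Q2 at `(W, K)`; everything else (Gross Prop. 6.2 (1) at `2` via
`TamagawaSelmerAtTwo.kolyvaginClass_mem_selmerLocalKer_two_pow_of_not_mem`, the sign law, the order law, Gross's one system of
choices `JET.exists_compatible_datum_of_dvd_of_grossCM`) is image-free.  This file re-threads them over the PER-INSTANCE relation:
* `kolyvaginRelationAtTwo_at_of_prop37_2` — Q2's body at `(W, K)` from `ρ̄_{E,2}` onto (`E(ℚ)[2] = 0`), `d_K ∉ {−3, −4}`, Heegner, and
  the named print fact `GrossLMS1991.prop37_2_reductionCongruence_inert N_W W K` (Gross 1991 Prop. 3.7 (2), image-free; a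
  `conditional-result` input exactly as for g16's `KolyvaginDescentTwo.kolyvaginRelationAtTwo_of_hasSurjectiveModNGaloisRep_two_of_prop37_2`,
  whose proof this is, per instance) through krr2's `GenusExact.kolyvaginRelationAtTwo_pair_of_congruence_offHabitat`;
* `kolyvaginRelationAtTwo_of_mul_eq`, `zsmul_kolyvaginClass_two_mem_selmerGroup(_of_forall)`,
  `zsmul_kolyvaginClass_two_mem_torsionLocalKer(_of_forall)`, `avoidance_of_kolyvaginSupply_intrinsic` — gk2-p2's statements and
  proofs VERBATIM with `(hQ2) (hcm) (hsur)` replaced by `(hρ2 : ρ̄_{E,2} onto) (h37 : prop37_2_reductionCongruence_inert N_W W K)`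
  (credit gk2-p2; the `1 ≤ L` binder, unused by the per-instance relation, is dropped).
So these hold for EVERY `W/ℚ` with `ρ̄_{E,2}` onto (CM or not), in particular on H₂.

References: [McCallumLMS1991] §4 Lemma 4.3, Prop. 4.4 «In particular» (p. 301), §5 p. 285, Prop. 5.2 (p. 310); [GrossLMS1991]
Prop. 3.7 (2) (p. 240), Prop. 5.4, Prop. 6.2; [Nekovar2007] Prop. 4.9.
-/

set_option autoImplicit false
-- the Theorems namespace of this sub repeats the summit name by design (D-0017 nested layout)
set_option linter.dupNamespace false

noncomputable section

open scoped Classical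

namespace Summit.BirchSwinnertonDyer.BirchSwinnertonDyer.Theorems.KolyvaginLowerTwo

open WeierstrassCurve NumberField IsDedekindDomain Field Literature.NumberTheory.EllipticCurves
  Literature.NumberTheory.GaloisRepresentations Literature.NumberTheory.EllipticCurves.ModularForms AddSubgroup
open Literature.NumberTheory.EllipticCurves.GrossLMS1991 (prop37_2_reductionCongruence_inert zhangKolyvaginPrime_ne_two)
open Summit.BirchSwinnertonDyer.BirchSwinnertonDyer.Theorems.GenusExact
open Summit.BirchSwinnertonDyer.Rank1Residual

variable {K : Type} [Field K] [NumberField K] (W : WeierstrassCurve ℚ) [W.IsElliptic] [W.IsGloballyMinimal]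
  [NeZero (W.conductorNorm ℤ)] (Dt : ModularParametrizationData W (W.conductorNorm ℤ)) (β : ℤ) (ι : K →+* ℂ)
  (τ : K ≃ₐ[ℚ] K) (L : ℕ)

/-! ## §1 Q2 at `(W, K)` from Gross 1991 Prop. 3.7 (2) and `ρ̄_{E,2}` onto -/

omit [W.IsGloballyMinimal] [NeZero (W.conductorNorm ℤ)] in
/-- `ρ̄_{E,2}` onto ⟹ `E(ℚ)[2] = 0` (no rational root of the `2`-division cubic). [folklore] -/
theorem torsionBy_two_eq_bot_of_hasSurjectiveModNGaloisRep_two (hρ2 : W.HasSurjectiveModNGaloisRep 2) :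
    AddSubgroup.torsionBy W.toAffine.Point (2 : ℤ) = ⊥ :=
  KolyvaginRankRigidity.torsionBy_two_eq_bot_iff_forall_two_nsmul.mpr ((hasSurjectiveModNGaloisRep_two_iff W).mp hρ2).1

/-- **Q2 (McCallum Prop. 4.4 «in particular») AT `2` FOR ONE PAIR `(W, K)`, from Gross 1991 Prop. 3.7 (2) by name** — the body of gk2's
route decl `KolyvaginRelationAtTwo` instantiated at `(W, K)`, for ANY `W/ℚ` with `ρ̄_{E,2}` onto (CM allowed), `K` imaginary quadratic
with `d_K ∉ {−3, −4}` and the Heegner hypothesis: for square-free `m·l` of Zhang–Kolyvagin primes of index `≥ M`, compatible data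
`d` (level `m`), `d'` (level `m·l`), a place `v ∋ l` and every `j`,
`(2^j c_M(d') ∈ Sel_v ↔ 2^j c_M(d') ∈ ker loc_v) ∧ (2^j c_M(d') ∈ ker loc_v ↔ 2^j c_M(d) ∈ ker loc_v)`.
Proof = g16's `kolyvaginRelationAtTwo_of_hasSurjectiveModNGaloisRep_two_of_prop37_2`, per instance (krr2's pair theorem
`kolyvaginRelationAtTwo_pair_of_congruence_offHabitat` + `congruence_pair_of_prop37_2_inert`).  CONDITIONAL on the displayed print
fact `h37`. [cite: McCallumLMS1991, §4 Prop. 4.4 «In particular» (p. 301)] [cite: GrossLMS1991, Prop. 3.7 (2) (p. 240)] -/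
theorem kolyvaginRelationAtTwo_at_of_prop37_2 (hρ2 : W.HasSurjectiveModNGaloisRep 2)
    (hK : IsImaginaryQuadratic K) (hD3 : NumberField.discr K ≠ -3) (hD4 : NumberField.discr K ≠ -4)
    (hH : SatisfiesHeegnerHypothesis (W.conductorNorm ℤ) K)
    (h37 : prop37_2_reductionCongruence_inert (W.conductorNorm ℤ) W K)
    (M : ℕ) {m l : ℕ} (hsq : Squarefree (m * l)) (hl : l.Prime) (hlm : ¬ l ∣ m)
    (hS : ∀ l' ∈ (m * l).primeFactors, Zhang2014.IsKolyvaginPrime (W.conductorNorm ℤ) W K 2 l' ∧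
      M ≤ Zhang2014.kolyvaginIndex W 2 l')
    (d : KolyvaginHeegnerData Dt β ι m) (d' : KolyvaginHeegnerData Dt β ι (m * l))
    (hσ : ∀ l' ∈ m.primeFactors, ∀ (x : ringClassField K ι m) (x' : ringClassField K ι (m * l)),
      (x : ℂ) = x' → ((d'.σ l' x' : ringClassField K ι (m * l)) : ℂ) = (d.σ l' x : ℂ))
    (hS₁ : ∀ s ∈ d.S, ∃ s' ∈ d'.S, ∀ (x : ringClassField K ι m) (x' : ringClassField K ι (m * l)),
      (x : ℂ) = x' → ((s' x' : ringClassField K ι (m * l)) : ℂ) = (s x : ℂ))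
    (hS₂ : ∀ s' ∈ d'.S, ∃ s ∈ d.S, ∀ (x : ringClassField K ι m) (x' : ringClassField K ι (m * l)),
      (x : ℂ) = x' → ((s' x' : ringClassField K ι (m * l)) : ℂ) = (s x : ℂ))
    (hemb : ∀ (x : ringClassField K ι m) (x' : ringClassField K ι (m * l)), (x : ℂ) = x' → d'.emb x' = d.emb x)
    (v : HeightOneSpectrum (𝓞 K)) (hv : (l : 𝓞 K) ∈ v.asIdeal) (j : ℕ) :
    (((2 ^ j : ℕ) : ℤ) • d'.kolyvaginClass Nat.prime_two M ∈
        selmerLocalKer (W.baseChange K) (v.adicCompletion K) ((2 ^ M : ℕ) : ℤ) ↔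
      ((2 ^ j : ℕ) : ℤ) • d'.kolyvaginClass Nat.prime_two M ∈
        (W.baseChange K).torsionLocalKer (v.adicCompletion K) ((2 ^ M : ℕ) : ℤ)) ∧
    (((2 ^ j : ℕ) : ℤ) • d'.kolyvaginClass Nat.prime_two M ∈
        (W.baseChange K).torsionLocalKer (v.adicCompletion K) ((2 ^ M : ℕ) : ℤ) ↔
      ((2 ^ j : ℕ) : ℤ) • d.kolyvaginClass Nat.prime_two M ∈
        (W.baseChange K).torsionLocalKer (v.adicCompletion K) ((2 ^ M : ℕ) : ℤ)) := by
  have htorQ := torsionBy_two_eq_bot_of_hasSurjectiveModNGaloisRep_two W hρ2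
  have hn0 : m * l ≠ 0 := hsq.ne_zero
  have hl' : l ∈ (m * l).primeFactors := Nat.mem_primeFactors.mpr ⟨hl, dvd_mul_left l m, hn0⟩
  have hodd' : ∀ q ∈ (m * l).primeFactors, q ≠ 2 := fun q hq ↦
    zhangKolyvaginPrime_ne_two Nat.prime_two (by norm_num) (hS q hq).1
  have hinert : ∀ q ∈ (m * l).primeFactors, ¬ q ∣ W.conductorNorm ℤ ∧
      ¬ ((q : ℤ) ∣ NumberField.discr K) ∧ (Ideal.span {(q : 𝓞 K)}).IsPrime :=
    fun q hq ↦ ⟨(hS q hq).1.2.1, (hS q hq).1.2.2.1, (hS q hq).1.2.2.2.2.1⟩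
  exact kolyvaginRelationAtTwo_pair_of_congruence_offHabitat hK hD3 hD4 hH htorQ Dt β ι M m l hsq hl hlm
    hS d d' hσ hS₁ hS₂ hemb (congruence_pair_of_prop37_2_inert h37 rfl hK ⟨hD3, hD4⟩ hH Dt β ι hsq
      hodd' hinert hl' (Nat.mul_div_cancel m hl.pos) d' d) v hv j

/-- **Q2 at `(W, K)` for a pair `(m, N = m·l)`** — gk2-p2's `PlusDescent.kolyvaginRelationAtTwo_of_mul_eq` with the route-decl
hypothesis replaced by the per-instance inputs (`ρ̄_{E,2}` onto, Gross 3.7 (2) at `(W, K)`). [cite: McCallumLMS1991, §4 Prop. 4.4]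
[cite: GrossLMS1991, Prop. 3.7 (2), Prop. 6.2 (2)] -/
theorem kolyvaginRelationAtTwo_of_mul_eq (hρ2 : W.HasSurjectiveModNGaloisRep 2)
    (hK : IsImaginaryQuadratic K) (hne3 : NumberField.discr K ≠ -3) (hne4 : NumberField.discr K ≠ -4)
    (hH : SatisfiesHeegnerHypothesis (W.conductorNorm ℤ) K)
    (h37 : prop37_2_reductionCongruence_inert (W.conductorNorm ℤ) W K)
    (M : ℕ) {m l N : ℕ} (hN : m * l = N) (hsq : Squarefree N) (hl : l.Prime) (hlm : ¬ l ∣ m)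
    (hK' : ∀ l' ∈ N.primeFactors, Zhang2014.IsKolyvaginPrime (W.conductorNorm ℤ) W K 2 l' ∧
      M ≤ Zhang2014.kolyvaginIndex W 2 l')
    (d : KolyvaginHeegnerData Dt β ι m) (d' : KolyvaginHeegnerData Dt β ι N)
    (hσ : ∀ l' ∈ m.primeFactors, ∀ (x : ringClassField K ι m) (x' : ringClassField K ι N),
      (x : ℂ) = x' → ((d'.σ l' x' : ringClassField K ι N) : ℂ) = (d.σ l' x : ℂ))
    (hS : ∀ s ∈ d.S, ∃ s' ∈ d'.S, ∀ (x : ringClassField K ι m) (x' : ringClassField K ι N),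
      (x : ℂ) = x' → ((s' x' : ringClassField K ι N) : ℂ) = (s x : ℂ))
    (hS' : ∀ s' ∈ d'.S, ∃ s ∈ d.S, ∀ (x : ringClassField K ι m) (x' : ringClassField K ι N),
      (x : ℂ) = x' → ((s' x' : ringClassField K ι N) : ℂ) = (s x : ℂ))
    (hemb : ∀ (x : ringClassField K ι m) (x' : ringClassField K ι N), (x : ℂ) = x' → d'.emb x' = d.emb x)
    (v : HeightOneSpectrum (𝓞 K)) (hv : ((l : ℕ) : 𝓞 K) ∈ v.asIdeal) (j : ℕ) :
    (((2 ^ j : ℕ) : ℤ) • d'.kolyvaginClass Nat.prime_two M ∈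
        selmerLocalKer (W.baseChange K) (v.adicCompletion K) ((2 ^ M : ℕ) : ℤ) ↔
      ((2 ^ j : ℕ) : ℤ) • d'.kolyvaginClass Nat.prime_two M ∈
        (W.baseChange K).torsionLocalKer (v.adicCompletion K) ((2 ^ M : ℕ) : ℤ)) ∧
    (((2 ^ j : ℕ) : ℤ) • d'.kolyvaginClass Nat.prime_two M ∈
        (W.baseChange K).torsionLocalKer (v.adicCompletion K) ((2 ^ M : ℕ) : ℤ) ↔
      ((2 ^ j : ℕ) : ℤ) • d.kolyvaginClass Nat.prime_two M ∈
        (W.baseChange K).torsionLocalKer (v.adicCompletion K) ((2 ^ M : ℕ) : ℤ)) := by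
  subst hN
  exact kolyvaginRelationAtTwo_at_of_prop37_2 W Dt β ι hρ2 hK hne3 hne4 hH h37 M hsq hl hlm hK' d d' hσ hS hS' hemb v hv j

/-! ## §2 McCallum's `hsel` at `2` and the own-prime vanishing (gk2-p2's statements, per-instance inputs) -/

/-- **`2^j · c_L(n) ∈ Sel^{(2^L)}(E_K/K)` when `2^j · c_L(n/ℓ) = 0` for all `ℓ ∣ n`** (McCallum: Lemma 4.3, Prop. 4.4, minimality), at
`p = 2`, for `W/ℚ` globally minimal with `ρ̄_{E,2}` onto and `Odd W.tamagawaProduct`, `K` imaginary quadratic with `d_K ∉ {−3,−4}`,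
Heegner, Gross 3.7 (2) at `(W, K)`; `n` square-free of Kolyvagin primes of index `≥ L`; `d` a datum at `n` with coherent data at
the `n/ℓ`.  gk2-p2's `PlusDescent.zsmul_kolyvaginClass_two_mem_selmerGroup`, proof verbatim.
[cite: McCallumLMS1991, §4 Lemma 4.3, Prop. 4.4; §5 p. 285] [cite: GrossLMS1991, Prop. 6.2] -/
theorem zsmul_kolyvaginClass_two_mem_selmerGroup (hρ2 : W.HasSurjectiveModNGaloisRep 2)
    (hK : IsImaginaryQuadratic K) (hne3 : NumberField.discr K ≠ -3) (hne4 : NumberField.discr K ≠ -4)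
    (hH : SatisfiesHeegnerHypothesis (W.conductorNorm ℤ) K) (hodd : Odd W.tamagawaProduct)
    (h37 : prop37_2_reductionCongruence_inert (W.conductorNorm ℤ) W K)
    (L : ℕ) (j : ℕ) {n : ℕ} (hn : Squarefree n)
    (hKol : ∀ ℓ ∈ n.primeFactors, Zhang2014.IsKolyvaginPrime (W.conductorNorm ℤ) W K 2 ℓ ∧ L ≤ Zhang2014.kolyvaginIndex W 2 ℓ)
    (d : KolyvaginHeegnerData Dt β ι n)
    (dsub : ∀ ℓ ∈ n.primeFactors, KolyvaginHeegnerData Dt β ι (n / ℓ))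
    (hσ : ∀ ℓ (hℓ : ℓ ∈ n.primeFactors), ∀ l' ∈ (n / ℓ).primeFactors,
      ∀ (x : ringClassField K ι (n / ℓ)) (x' : ringClassField K ι n),
      (x : ℂ) = x' → ((d.σ l' x' : ringClassField K ι n) : ℂ) = ((dsub ℓ hℓ).σ l' x : ℂ))
    (hS : ∀ ℓ (hℓ : ℓ ∈ n.primeFactors), ∀ s ∈ (dsub ℓ hℓ).S, ∃ s' ∈ d.S,
      ∀ (x : ringClassField K ι (n / ℓ)) (x' : ringClassField K ι n), (x : ℂ) = x' → ((s' x' : ringClassField K ι n) : ℂ) = (s x : ℂ))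
    (hS' : ∀ ℓ (hℓ : ℓ ∈ n.primeFactors), ∀ s' ∈ d.S, ∃ s ∈ (dsub ℓ hℓ).S,
      ∀ (x : ringClassField K ι (n / ℓ)) (x' : ringClassField K ι n), (x : ℂ) = x' → ((s' x' : ringClassField K ι n) : ℂ) = (s x : ℂ))
    (hemb : ∀ ℓ (hℓ : ℓ ∈ n.primeFactors), ∀ (x : ringClassField K ι (n / ℓ)) (x' : ringClassField K ι n),
      (x : ℂ) = x' → d.emb x' = (dsub ℓ hℓ).emb x)
    (hsub : ∀ ℓ (hℓ : ℓ ∈ n.primeFactors), ((2 ^ j : ℕ) : ℤ) • (dsub ℓ hℓ).kolyvaginClass Nat.prime_two L = 0) :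
    ((2 ^ j : ℕ) : ℤ) • d.kolyvaginClass Nat.prime_two L ∈ selmerGroup (W.baseChange K) ((2 ^ L : ℕ) : ℤ) := by
  have hn0 : n ≠ 0 := hn.ne_zero
  rw [mem_selmerGroup_iff]
  refine ⟨fun v ↦ ?_, fun w ↦ mem_selmerLocalKer_infinitePlace_of_isImaginaryQuadratic hK _ w _⟩
  by_cases hv : ((n : ℕ) : 𝓞 K) ∈ v.asIdeal
  · -- `v ∣ ℓ ∣ n`: Q2 at `n/ℓ ⊂ n`
    obtain ⟨ℓ, hℓ, hvℓ⟩ := (JET.SelmerVocabulary.natCast_mem_iff_exists_primeFactor_mem (K := K) hn0 v).mp hv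
    have hℓp : ℓ.Prime := Nat.prime_of_mem_primeFactors hℓ
    have hℓn : ℓ ∣ n := Nat.dvd_of_mem_primeFactors hℓ
    have hN : n / ℓ * ℓ = n := Nat.div_mul_cancel hℓn
    have hlm : ¬ ℓ ∣ n / ℓ := fun h ↦ by
      have h2 : ℓ * ℓ ∣ n := by
        have h3 := Nat.mul_dvd_mul_left ℓ h
        rwa [Nat.mul_div_cancel' hℓn] at h3
      exact hℓp.one_lt.ne' (Nat.isUnit_iff.mp (hn ℓ h2))
    have hQ := kolyvaginRelationAtTwo_of_mul_eq W Dt β ι hρ2 hK hne3 hne4 hH h37 L hN hn hℓp hlm hKol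
      (dsub ℓ hℓ) d (hσ ℓ hℓ) (hS ℓ hℓ) (hS' ℓ hℓ) (hemb ℓ hℓ) v hvℓ j
    refine hQ.1.mpr (hQ.2.mpr ?_)
    rw [hsub ℓ hℓ]
    exact AddSubgroup.zero_mem _
  · -- `v ∤ n`: Gross Prop. 6.2 (1) at `2`
    exact AddSubgroup.zsmul_mem _
      (P2.TamagawaSelmerAtTwo.kolyvaginClass_mem_selmerLocalKer_two_pow_of_not_mem d hK hH hodd hn0 L v hv) _

/-- **`loc_v (2^j c_L(n)) = 0` at `v ∣ ℓ ∣ n` when `2^j c_L(n/ℓ) = 0`** (Q2, second clause; coherent data at `n/ℓ ⊂ n`) — gk2-p2's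
`PlusDescent.zsmul_kolyvaginClass_two_mem_torsionLocalKer`, per-instance inputs. [cite: McCallumLMS1991, §4 Prop. 4.4; §5 p. 310]
[cite: GrossLMS1991, Prop. 6.2 (2)] -/
theorem zsmul_kolyvaginClass_two_mem_torsionLocalKer (hρ2 : W.HasSurjectiveModNGaloisRep 2)
    (hK : IsImaginaryQuadratic K) (hne3 : NumberField.discr K ≠ -3) (hne4 : NumberField.discr K ≠ -4)
    (hH : SatisfiesHeegnerHypothesis (W.conductorNorm ℤ) K)
    (h37 : prop37_2_reductionCongruence_inert (W.conductorNorm ℤ) W K)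
    (L : ℕ) (j : ℕ) {n : ℕ} (hn : Squarefree n)
    (hKol : ∀ ℓ ∈ n.primeFactors, Zhang2014.IsKolyvaginPrime (W.conductorNorm ℤ) W K 2 ℓ ∧ L ≤ Zhang2014.kolyvaginIndex W 2 ℓ)
    (d : KolyvaginHeegnerData Dt β ι n) {ℓ : ℕ} (hℓ : ℓ ∈ n.primeFactors) (dsub : KolyvaginHeegnerData Dt β ι (n / ℓ))
    (hσ : ∀ l' ∈ (n / ℓ).primeFactors, ∀ (x : ringClassField K ι (n / ℓ)) (x' : ringClassField K ι n),
      (x : ℂ) = x' → ((d.σ l' x' : ringClassField K ι n) : ℂ) = (dsub.σ l' x : ℂ))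
    (hS : ∀ s ∈ dsub.S, ∃ s' ∈ d.S, ∀ (x : ringClassField K ι (n / ℓ)) (x' : ringClassField K ι n),
      (x : ℂ) = x' → ((s' x' : ringClassField K ι n) : ℂ) = (s x : ℂ))
    (hS' : ∀ s' ∈ d.S, ∃ s ∈ dsub.S, ∀ (x : ringClassField K ι (n / ℓ)) (x' : ringClassField K ι n),
      (x : ℂ) = x' → ((s' x' : ringClassField K ι n) : ℂ) = (s x : ℂ))
    (hemb : ∀ (x : ringClassField K ι (n / ℓ)) (x' : ringClassField K ι n), (x : ℂ) = x' → d.emb x' = dsub.emb x)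
    (hsub : ((2 ^ j : ℕ) : ℤ) • dsub.kolyvaginClass Nat.prime_two L = 0)
    (v : HeightOneSpectrum (𝓞 K)) (hv : ((ℓ : ℕ) : 𝓞 K) ∈ v.asIdeal) :
    ((2 ^ j : ℕ) : ℤ) • d.kolyvaginClass Nat.prime_two L ∈
      (W.baseChange K).torsionLocalKer (v.adicCompletion K) ((2 ^ L : ℕ) : ℤ) := by
  have hℓp : ℓ.Prime := Nat.prime_of_mem_primeFactors hℓ
  have hℓn : ℓ ∣ n := Nat.dvd_of_mem_primeFactors hℓ
  have hN : n / ℓ * ℓ = n := Nat.div_mul_cancel hℓn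
  have hlm : ¬ ℓ ∣ n / ℓ := fun h ↦ by
    have h2 : ℓ * ℓ ∣ n := by
      have h3 := Nat.mul_dvd_mul_left ℓ h
      rwa [Nat.mul_div_cancel' hℓn] at h3
    exact hℓp.one_lt.ne' (Nat.isUnit_iff.mp (hn ℓ h2))
  have hQ := kolyvaginRelationAtTwo_of_mul_eq W Dt β ι hρ2 hK hne3 hne4 hH h37 L hN hn hℓp hlm hKol dsub d hσ hS hS' hemb
    v hv j
  refine hQ.2.mpr ?_
  rw [hsub]
  exact AddSubgroup.zero_mem _

/-! ## §3 Intrinsic forms (Gross's one system of choices reconstructed downwards) -/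

/-- **`loc_v (2^j c_L(n)) = 0` at `v ∣ ℓ ∣ n`, intrinsic form** (`2^j c_L(e) = 0` for EVERY datum `e` at `n/ℓ`) — gk2-p2's
`PlusDescent.zsmul_kolyvaginClass_two_mem_torsionLocalKer_of_forall`, per-instance inputs. [cite: McCallumLMS1991, §4 Prop. 4.4]
[cite: GrossLMS1991, §3–§4] -/
theorem zsmul_kolyvaginClass_two_mem_torsionLocalKer_of_forall (hρ2 : W.HasSurjectiveModNGaloisRep 2)
    (hK : IsImaginaryQuadratic K) (hne3 : NumberField.discr K ≠ -3) (hne4 : NumberField.discr K ≠ -4)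
    (hH : SatisfiesHeegnerHypothesis (W.conductorNorm ℤ) K)
    (h37 : prop37_2_reductionCongruence_inert (W.conductorNorm ℤ) W K)
    (L : ℕ) (j : ℕ) {n : ℕ} (hn : Squarefree n)
    (hKol : ∀ ℓ ∈ n.primeFactors, Zhang2014.IsKolyvaginPrime (W.conductorNorm ℤ) W K 2 ℓ ∧ L ≤ Zhang2014.kolyvaginIndex W 2 ℓ)
    (d : KolyvaginHeegnerData Dt β ι n)
    (hsub : ∀ ℓ ∈ n.primeFactors, ∀ e : KolyvaginHeegnerData Dt β ι (n / ℓ), ((2 ^ j : ℕ) : ℤ) • e.kolyvaginClass Nat.prime_two L = 0)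
    {ℓ : ℕ} (hℓ : ℓ ∈ n.primeFactors) (v : HeightOneSpectrum (𝓞 K)) (hv : ((ℓ : ℕ) : 𝓞 K) ∈ v.asIdeal) :
    ((2 ^ j : ℕ) : ℤ) • d.kolyvaginClass Nat.prime_two L ∈
      (W.baseChange K).torsionLocalKer (v.adicCompletion K) ((2 ^ L : ℕ) : ℤ) := by
  have hD : NumberField.discr K < -4 := X11b.KolyvaginAssembly.discr_lt_neg_four hK ⟨hne3, hne4⟩
  obtain ⟨e, hσ, hS, hS', hemb⟩ := JET.exists_compatible_datum_of_dvd_of_grossCM hK hD hH 2 Dt β ι hn (fun l hl ↦ (hKol l hl).1)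
    (Nat.div_dvd_of_dvd (Nat.dvd_of_mem_primeFactors hℓ)) d
  exact zsmul_kolyvaginClass_two_mem_torsionLocalKer W Dt β ι hρ2 hK hne3 hne4 hH h37 L j hn hKol d hℓ e hσ hS hS' hemb
    (hsub ℓ hℓ e) v hv

/-- **`2^j c_L(n) ∈ Sel^{(2^L)}(E_K/K)`, intrinsic form** (`2^j c_L(e) = 0` for every datum `e` at every `n/ℓ`) — gk2-p2's
`PlusDescent.zsmul_kolyvaginClass_two_mem_selmerGroup_of_forall`, per-instance inputs.
[cite: McCallumLMS1991, §4 Lemma 4.3, Prop. 4.4; §5 p. 285] [cite: GrossLMS1991, Prop. 6.2] -/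
theorem zsmul_kolyvaginClass_two_mem_selmerGroup_of_forall (hρ2 : W.HasSurjectiveModNGaloisRep 2)
    (hK : IsImaginaryQuadratic K) (hne3 : NumberField.discr K ≠ -3) (hne4 : NumberField.discr K ≠ -4)
    (hH : SatisfiesHeegnerHypothesis (W.conductorNorm ℤ) K) (hodd : Odd W.tamagawaProduct)
    (h37 : prop37_2_reductionCongruence_inert (W.conductorNorm ℤ) W K)
    (L : ℕ) (j : ℕ) {n : ℕ} (hn : Squarefree n)
    (hKol : ∀ ℓ ∈ n.primeFactors, Zhang2014.IsKolyvaginPrime (W.conductorNorm ℤ) W K 2 ℓ ∧ L ≤ Zhang2014.kolyvaginIndex W 2 ℓ)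
    (d : KolyvaginHeegnerData Dt β ι n)
    (hsub : ∀ ℓ ∈ n.primeFactors, ∀ e : KolyvaginHeegnerData Dt β ι (n / ℓ), ((2 ^ j : ℕ) : ℤ) • e.kolyvaginClass Nat.prime_two L = 0) :
    ((2 ^ j : ℕ) : ℤ) • d.kolyvaginClass Nat.prime_two L ∈ selmerGroup (W.baseChange K) ((2 ^ L : ℕ) : ℤ) := by
  have hD : NumberField.discr K < -4 := X11b.KolyvaginAssembly.discr_lt_neg_four hK ⟨hne3, hne4⟩
  have hdata : ∀ ℓ ∈ n.primeFactors, ∃ e : KolyvaginHeegnerData Dt β ι (n / ℓ),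
      (∀ l' ∈ (n / ℓ).primeFactors, ∀ (x : ringClassField K ι (n / ℓ)) (x' : ringClassField K ι n),
        (x : ℂ) = x' → ((d.σ l' x' : ringClassField K ι n) : ℂ) = (e.σ l' x : ℂ)) ∧
      (∀ s ∈ e.S, ∃ s' ∈ d.S, ∀ (x : ringClassField K ι (n / ℓ)) (x' : ringClassField K ι n),
        (x : ℂ) = x' → ((s' x' : ringClassField K ι n) : ℂ) = (s x : ℂ)) ∧
      (∀ s' ∈ d.S, ∃ s ∈ e.S, ∀ (x : ringClassField K ι (n / ℓ)) (x' : ringClassField K ι n),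
        (x : ℂ) = x' → ((s' x' : ringClassField K ι n) : ℂ) = (s x : ℂ)) ∧
      (∀ (x : ringClassField K ι (n / ℓ)) (x' : ringClassField K ι n), (x : ℂ) = x' → d.emb x' = e.emb x) := fun ℓ hℓ ↦
    JET.exists_compatible_datum_of_dvd_of_grossCM hK hD hH 2 Dt β ι hn (fun l hl ↦ (hKol l hl).1)
      (Nat.div_dvd_of_dvd (Nat.dvd_of_mem_primeFactors hℓ)) d
  choose dsub hσ hS hS' hemb using hdata
  exact zsmul_kolyvaginClass_two_mem_selmerGroup W Dt β ι hρ2 hK hne3 hne4 hH hodd h37 L j hn hKol d dsub hσ hS hS' hemb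
    (fun ℓ hℓ ↦ hsub ℓ hℓ (dsub ℓ hℓ))

/-! ## §4 Prop. 5.2 at `2` in intrinsic avoidance form ⟹ the avoidance binder of the descent layer -/

/-- **PROP. 5.2 AT `2`, INTRINSIC AVOIDANCE FORM ⟹ the avoidance binder** (sign `ε`, seed `C₀`, `(s, a) = (b+1, M'−k)`) — gk2-p2's
`PlusDescent.avoidance_of_kolyvaginSupply_intrinsic`, per-instance inputs (`ρ̄_{E,2}` onto, Gross 3.7 (2) at `(W, K)`), proof verbatim.
[cite: McCallumLMS1991, §5 Prop. 5.2, p. 285] [cite: GrossLMS1991, Prop. 5.4, Prop. 6.2] -/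
theorem avoidance_of_kolyvaginSupply_intrinsic (hρ2 : W.HasSurjectiveModNGaloisRep 2)
    (hK : IsImaginaryQuadratic K) (hne3 : NumberField.discr K ≠ -3) (hodd' : Odd (NumberField.discr K))
    (hH : SatisfiesHeegnerHypothesis (W.conductorNorm ℤ) K) (hodd : Odd W.tamagawaProduct)
    (h37 : prop37_2_reductionCongruence_inert (W.conductorNorm ℤ) W K) (hτ : τ ≠ 1)
    (ε : ℤ) {M' k b : ℕ} (hL : 1 ≤ L) (hkM : k ≤ M') (hML : M' ≤ L)
    (C₀ : AddSubgroup (galH1Torsion (W.baseChange K) ((2 ^ L : ℕ) : ℤ)))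
    (hP52 : ∀ (i : ℕ) (u : Fin i → galH1Torsion (W.baseChange K) ((2 ^ L : ℕ) : ℤ)), i ≤ b →
      (∀ j, u j ∈ selmerGroup (W.baseChange K) ((2 ^ L : ℕ) : ℤ) ∧ conjAct W τ ((2 ^ L : ℕ) : ℤ) (u j) = ε • u j) →
      ∃ (n : ℕ) (_ : Squarefree n)
        (_ : ∀ ℓ ∈ n.primeFactors, Zhang2014.IsKolyvaginPrime (W.conductorNorm ℤ) W K 2 ℓ ∧ L ≤ Zhang2014.kolyvaginIndex W 2 ℓ)
        (d : KolyvaginHeegnerData Dt β ι n),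
        (∀ ℓ ∈ n.primeFactors, ∀ e : KolyvaginHeegnerData Dt β ι (n / ℓ),
          ((2 ^ (L - M') : ℕ) : ℤ) • e.kolyvaginClass Nat.prime_two L = 0) ∧
        addOrderOf (d.kolyvaginClass Nat.prime_two L) = 2 ^ (L - k) ∧
        -W.rootNumber * (-1) ^ n.primeFactors.card = ε ∧
        Disjoint (zmultiples (((2 ^ (L - M') : ℕ) : ℤ) • d.kolyvaginClass Nat.prime_two L))
          (AddSubgroup.closure (Set.range u) ⊔ C₀)) :
    ∀ i < b + 1, ∀ u : Fin i → galH1Torsion (W.baseChange K) ((2 ^ L : ℕ) : ℤ),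
      (∀ j, u j ∈ selmerGroup (W.baseChange K) ((2 ^ L : ℕ) : ℤ) ∧ conjAct W τ ((2 ^ L : ℕ) : ℤ) (u j) = ε • u j) →
      (∀ j, addOrderOf (u j) = 2 ^ (M' - k)) →
      ∃ y : galH1Torsion (W.baseChange K) ((2 ^ L : ℕ) : ℤ),
        (y ∈ selmerGroup (W.baseChange K) ((2 ^ L : ℕ) : ℤ) ∧ conjAct W τ ((2 ^ L : ℕ) : ℤ) y = ε • y) ∧
        addOrderOf y = 2 ^ (M' - k) ∧ Disjoint (zmultiples y) (AddSubgroup.closure (Set.range u) ⊔ C₀) := by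
  have hne4 : NumberField.discr K ≠ -4 := fun h ↦ by
    rw [h] at hodd'
    exact (Int.not_even_iff_odd.mpr hodd') ⟨-2, by norm_num⟩
  have hsurj1 : W.HasSurjectiveModNGaloisRep ((2 : ℤ) ^ 1) := by simpa using hρ2
  intro i hi u hu _
  obtain ⟨n, hn, hKol, d, hsub, hordc, hsign, hdisj⟩ := hP52 i u (Nat.lt_succ_iff.mp hi) hu
  refine ⟨((2 ^ (L - M') : ℕ) : ℤ) • d.kolyvaginClass Nat.prime_two L, ⟨?_, ?_⟩, ?_, hdisj⟩
  · exact zsmul_kolyvaginClass_two_mem_selmerGroup_of_forall W Dt β ι hρ2 hK hne3 hne4 hH hodd h37 L (L - M') hn hKol d hsub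
  · rw [PlusDescent.conjAct_zsmul_kolyvaginClass_two W Dt β ι hK hne3 hne4 hodd' hH hsurj1 τ hτ hn hL hKol d (L - M'), hsign]
  · exact PlusDescent.addOrderOf_zsmul_kolyvaginClass_two W Dt β ι d hkM hML hordc

end Summit.BirchSwinnertonDyer.BirchSwinnertonDyer.Theorems.KolyvaginLowerTwo

end
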